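import Mathlib
import HarnessLib
import Literature.Analysis.FluidPDE.LocalTypeI
import Literature.Analysis.FluidPDE.EnstrophyGronwall
import Literature.Analysis.FluidPDE.JiaSverak2013Lemma8SliceTools
import Summits.NavierStokesRegularity.NavierStokesRegularity.Theorems.QuarterLogPincerTypeIQuantSubcubicExpFrameTools
import Summits.NavierStokesRegularity.NavierStokesRegularity.Theorems.QuarterLogPincerTypeIQuantSubcubicExpZoomEnergyA
import Summits.NavierStokesRegularity.NavierStokesRegularity.Theorems.QuarterLogPincerTypeIQuantSubcubicExpStubUniformScaledEnergy

/-!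
# Crux `QuarterLogPincer.TypeIQuantSubcubicExp` (stmt-NavierStokesRegularity-24077), line `thin_cascade`:
  the UNIFORM local Type-I bound of the zooms of a Tao frame (Albritton–Barker's `𝐈 ≤ I(M)`)

Helper file (`--supports stmt-NavierStokesRegularity-24077 --as helper`, lead prover ns-tc-p1 g3) toward
the registered stub `stub_thinObjectExtraction` (S2, skeleton v5), clause (3) `SingularAt`: the only
input still missing for `isBackwardSingularPoint_zoomLimit` (`…ZoomSingular`, p612981) is a bound of
`typeIBound (Q(2^m, 0)) w q ∇w` for the zooms `w = ρ • stPull (ρ²) ρ T x₀ u`, `q = ρ² • stPull (ρ²) ρ T x₀ p`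
of a Tao frame with the Type-I rate, uniform in the frame.  This file proves it from the (now proved)
4th stub `UniformScaledEnergy` (`stub_uniformScaledEnergy`), applied to the frame RESTRICTED IN TIME to
the original vertex of each sub-cylinder (`frame_restrict`, `typeI_restrict`):

* `A` part: `cknA_zoom_le` (`…ZoomEnergyA`);
* `E` part: `cknE_zoom_le` — chain rule `∇w(s,y) = ρ² ∇u(Φ(s,y))`, `|·|²_F ≤ 3‖·‖²`, the
  space–time substitution `setLIntegral_preimage_comp_stAffine` and `lintegral_prod_le`;
* `D` part: `cknDOsc_zoom_le` — the ball mean is scale covariant (`setAverage_ball_zoom`), same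
  substitution;
* `lintegral_rpow_neg_half_le` — `∫_a^b (−s)^{-1/2} ≤ 2√(b−a)` (for the `C` part, next file).

The `C` part and the assembly `𝐈(Q(2^m,0); w, q, ∇w) ≤ I(M)` follow in the sequel file.

HONEST FRAMING: bookkeeping toward one registered stub of an open crux; nothing about Navier–Stokes
regularity is proved; no summit statement is proved by this file.
-/

noncomputable section

-- the summit-side namespace `Summit.NavierStokesRegularity.NavierStokesRegularity.…` (single-conjunct summit,
-- D-0017) repeats a component by design; the dupNamespace linter would flag every declaration.
set_option linter.dupNamespace false

namespace Summit.NavierStokesRegularity.NavierStokesRegularity.Theorems.ThinCascade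

open MeasureTheory Set Function Metric Filter Topology
open scoped ENNReal NNReal
open Literature.Analysis Literature.Analysis.FluidPDE
open Summit.NavierStokesRegularity.NavierStokesRegularity.Cruxes.TypeIQuantSubcubicExp.ThinCascade
  (TaoFrame UniformScaledEnergy stub_uniformScaledEnergy)

/-! ### Geometry of sub-cylinders and the space–time substitution -/

/-- A sub-cylinder `Q(z', r') ⊆ Q(R, 0)` with `r' > 0` has `z'.1 ≤ 0` and `z'.1 − r'^2 ≥ −R²`.
[folklore] -/
theorem subcylinder_time_bounds {R r' : ℝ} {z' : ℝ × EuclideanSpace ℝ (Fin 3)} (hr' : 0 < r')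
    (h : parabolicCylinder r' z' ⊆ parabolicCylinder R (0 : ℝ × EuclideanSpace ℝ (Fin 3))) :
    z'.1 ≤ 0 ∧ -R ^ 2 ≤ z'.1 - r' ^ 2 := by
  have hmem : ∀ s ∈ Ioo (z'.1 - r' ^ 2) z'.1, s ∈ Ioo (-R ^ 2) 0 := by
    intro s hs
    have hz : (s, z'.2) ∈ parabolicCylinder r' z' := by
      rw [mem_parabolicCylinder]; exact ⟨hs, by simpa using hr'⟩
    have := h hz
    rw [mem_parabolicCylinder] at this
    simpa using this.1
  constructor
  · by_contra hlt
    push Not at hlt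
    have hr2 : 0 < r' ^ 2 := by positivity
    obtain ⟨s, hs1, hs2⟩ : ∃ s, max (z'.1 - r' ^ 2) 0 < s ∧ s < z'.1 :=
      exists_between (max_lt (by linarith) hlt)
    have := hmem s ⟨lt_of_le_of_lt (le_max_left _ _) hs1, hs2⟩
    linarith [this.2, le_max_right (z'.1 - r' ^ 2) 0]
  · by_contra hlt
    push Not at hlt
    obtain ⟨s, hs1, hs2⟩ : ∃ s, z'.1 - r' ^ 2 < s ∧ s < min z'.1 (-R ^ 2) :=
      exists_between (lt_min (by nlinarith) hlt)
    have := hmem s ⟨hs1, lt_of_lt_of_le hs2 (min_le_left _ _)⟩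
    linarith [this.1, min_le_right z'.1 (-R ^ 2)]

/-- The zoom map `Φ(s,y) = (T + ρ²s, x₀ + ρy)` pulls the original cylinder
`Q((T + ρ²z'.1, x₀ + ρz'.2), ρr')` back to `Q(z', r')`. [folklore] -/
theorem stAffine_preimage_parabolicCylinder {ρ : ℝ} (hρ : 0 < ρ) (T : ℝ)
    (x₀ : EuclideanSpace ℝ (Fin 3)) (r' : ℝ) (z' : ℝ × EuclideanSpace ℝ (Fin 3)) :
    stAffine (ρ ^ 2) ρ T x₀ ⁻¹'
        parabolicCylinder (ρ * r') ((T + ρ ^ 2 * z'.1, x₀ + ρ • z'.2) : ℝ × EuclideanSpace ℝ (Fin 3)) =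
      parabolicCylinder r' z' := by
  have hρ2 : 0 < ρ ^ 2 := by positivity
  rw [parabolicCylinder, parabolicCylinder, stAffine_preimage_cylinder hρ2 hρ]
  dsimp only
  have e1 : (T + ρ ^ 2 * z'.1 - (ρ * r') ^ 2 - T) / ρ ^ 2 = z'.1 - r' ^ 2 := by
    rw [div_eq_iff hρ2.ne']; ring
  have e2 : (T + ρ ^ 2 * z'.1 - T) / ρ ^ 2 = z'.1 := by
    rw [div_eq_iff hρ2.ne']; ring
  have e3 : ρ⁻¹ • (x₀ + ρ • z'.2 - x₀) = z'.2 := by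
    rw [add_sub_cancel_left, smul_smul, inv_mul_cancel₀ hρ.ne', one_smul]
  have e4 : ρ * r' / ρ = r' := by field_simp
  rw [e1, e2, e3, e4]

/-- **Ball means are scale covariant**: `⨍_{B(c,r')} G(x₀ + ρy) dy = ⨍_{B(x₀+ρc, ρr')} G`, `ρ > 0`.
[folklore] -/
theorem setAverage_ball_zoom (G : EuclideanSpace ℝ (Fin 3) → ℝ) {ρ : ℝ} (hρ : 0 < ρ)
    (x₀ c : EuclideanSpace ℝ (Fin 3)) (r' : ℝ) :
    ⨍ y in ball c r', G (x₀ + ρ • y) = ⨍ x in ball (x₀ + ρ • c) (ρ * r'), G x := by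
  set B : Set (EuclideanSpace ℝ (Fin 3)) := ball c r' with hB
  set B' : Set (EuclideanSpace ℝ (Fin 3)) := ball (x₀ + ρ • c) (ρ * r') with hB'
  have hmem : ∀ y, y ∈ B ↔ ρ • y + x₀ ∈ B' := by
    intro y
    rw [hB, hB', mem_ball, mem_ball, dist_eq_norm, dist_eq_norm,
      show ρ • y + x₀ - (x₀ + ρ • c) = ρ • (y - c) by rw [smul_sub]; abel,
      norm_smul, Real.norm_of_nonneg hρ.le]
    exact ⟨fun h => by nlinarith, fun h => by nlinarith⟩
  have key : ∀ y, B.indicator (fun y => G (x₀ + ρ • y)) y = B'.indicator G (ρ • y + x₀) := by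
    intro y
    by_cases hy : y ∈ B
    · rw [indicator_of_mem hy, indicator_of_mem ((hmem y).1 hy), add_comm]
    · rw [indicator_of_notMem hy, indicator_of_notMem (fun h => hy ((hmem y).2 h))]
  have hBm : MeasurableSet B := measurableSet_ball
  have hB'm : MeasurableSet B' := measurableSet_ball
  have hint : ∫ y in B, G (x₀ + ρ • y) = (ρ ^ 3)⁻¹ * ∫ x in B', G x := by
    rw [← integral_indicator hBm, ← integral_indicator hB'm]
    simp_rw [key]
    have h1 : (fun y => B'.indicator G (ρ • y + x₀)) =
        fun y => (fun z => B'.indicator G (ρ • z)) (y + ρ⁻¹ • x₀) := by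
      funext y
      simp only [smul_add, smul_smul, mul_inv_cancel₀ hρ.ne', one_smul]
    rw [h1, integral_add_right_eq_self (fun z => B'.indicator G (ρ • z)) (ρ⁻¹ • x₀),
      Measure.integral_comp_smul, finrank_euclideanSpace_fin, smul_eq_mul, abs_of_pos (by positivity)]
  by_cases hr' : 0 < r'
  · have hvol : (volume B').toReal = ρ ^ 3 * (volume B).toReal := by
      rw [hB', hB, Measure.addHaar_ball volume _ (by positivity : (0 : ℝ) ≤ ρ * r'),
        Measure.addHaar_ball volume c hr'.le, finrank_euclideanSpace_fin, ENNReal.toReal_mul,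
        ENNReal.toReal_mul, ENNReal.toReal_ofReal (by positivity), ENNReal.toReal_ofReal (by positivity)]
      ring
    rw [setAverage_eq, setAverage_eq, hint, measureReal_def, measureReal_def, hvol, smul_eq_mul,
      smul_eq_mul, mul_inv]
    ring
  · have h1 : B = ∅ := by rw [hB]; exact ball_eq_empty.2 (not_lt.1 hr')
    have h2 : B' = ∅ := by
      rw [hB']; exact ball_eq_empty.2 (by nlinarith [not_lt.1 hr'])
    rw [h1, h2]
    simp

/-! ### The `E`, `D`, `C` parts of the uniform bound -/

/-- **The `E` part of the uniform local Type-I bound of the zoom.**  If the frame obeys the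
`E`-clause of `UniformScaledEnergy` at the vertex `(T + ρ²z'.1, x₀ + ρz'.2)` and radius `ρr'`, then
`E(Q(z',r'); ∇w) ≤ 3C` for `w = ρ • stPull (ρ²) ρ T x₀ u` (`|∇w|²_F ≤ 3‖∇w‖²`, `∇w = ρ²(∇u)∘Φ`,
substitution `dz = ρ⁵ dz'`). [folklore] -/
theorem cknE_zoom_le {ρ C T r' : ℝ} (hρ : 0 < ρ) (hr' : 0 < r')
    {x₀ : EuclideanSpace ℝ (Fin 3)} {u : ℝ → EuclideanSpace ℝ (Fin 3) → EuclideanSpace ℝ (Fin 3)}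
    {z' : ℝ × EuclideanSpace ℝ (Fin 3)}
    (hE : ∫⁻ t in Icc (T + ρ ^ 2 * z'.1 - (ρ * r') ^ 2) (T + ρ ^ 2 * z'.1),
      ∫⁻ x in ball (x₀ + ρ • z'.2) (ρ * r'), ENNReal.ofReal (‖fderiv ℝ (u t) x‖ ^ 2) ≤
        ENNReal.ofReal (C * (ρ * r'))) :
    cknE r' z' (fun s y => fderiv ℝ ((ρ • stPull (ρ ^ 2) ρ T x₀ u) s) y) ≤ ENNReal.ofReal (3 * C) := by
  have hρ2 : 0 < ρ ^ 2 := by positivity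
  set t₁ : ℝ := T + ρ ^ 2 * z'.1 with ht₁
  set x₁ : EuclideanSpace ℝ (Fin 3) := x₀ + ρ • z'.2 with hx₁
  set S : Set (ℝ × EuclideanSpace ℝ (Fin 3)) := parabolicCylinder (ρ * r') ((t₁, x₁) : ℝ × _) with hS
  set F : ℝ × EuclideanSpace ℝ (Fin 3) → ℝ≥0∞ := fun z =>
    ENNReal.ofReal (3 * ρ ^ 4) * ENNReal.ofReal (‖fderiv ℝ (u z.1) z.2‖ ^ 2) with hF
  -- pointwise: the integrand of `E` for the zoom is `≤ F ∘ Φ`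
  have hpt : ∀ z : ℝ × EuclideanSpace ℝ (Fin 3),
      ENNReal.ofReal (frobeniusNormSq (fderiv ℝ ((ρ • stPull (ρ ^ 2) ρ T x₀ u) z.1) z.2)) ≤
        F (stAffine (ρ ^ 2) ρ T x₀ z) := by
    intro z
    have hgrad : fderiv ℝ ((ρ • stPull (ρ ^ 2) ρ T x₀ u) z.1) z.2 =
        (ρ ^ 2) • fderiv ℝ (u (T + ρ ^ 2 * z.1)) (x₀ + ρ • z.2) := by
      rw [show (ρ • stPull (ρ ^ 2) ρ T x₀ u) z.1 = ρ • (stPull (ρ ^ 2) ρ T x₀ u z.1) from rfl,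
        fderiv_const_smul_field, Pi.smul_apply, fderiv_stPull, smul_smul, sq]
    rw [hgrad, frobeniusNormSq_smul_eq, hF, stAffine_apply]
    dsimp only
    rw [← ENNReal.ofReal_mul (by positivity)]
    refine ENNReal.ofReal_le_ofReal ?_
    have h3 := frobeniusNormSq_le_three_mul (F := EuclideanSpace ℝ (Fin 3))
      (fderiv ℝ (u (T + ρ ^ 2 * z.1)) (x₀ + ρ • z.2))
    nlinarith [sq_nonneg (ρ ^ 2)]
  -- the substitution
  have hpre : stAffine (ρ ^ 2) ρ T x₀ ⁻¹' S = parabolicCylinder r' z' := by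
    rw [hS, ht₁, hx₁]; exact stAffine_preimage_parabolicCylinder hρ T x₀ r' z'
  have hsub := setLIntegral_preimage_comp_stAffine hρ2 hρ T x₀ F S
  rw [hpre, finrank_euclideanSpace_fin] at hsub
  -- Tonelli (inequality, no measurability) and the `E` clause
  have hFS : ∫⁻ z in S, F z ≤ ENNReal.ofReal (3 * ρ ^ 4) * ENNReal.ofReal (C * (ρ * r')) := by
    rw [hS, parabolicCylinder]
    dsimp only
    rw [Measure.volume_eq_prod, ← Measure.prod_restrict]
    calc ∫⁻ z, F z ∂(volume.restrict (Ioo (t₁ - (ρ * r') ^ 2) t₁)).prod (volume.restrict (ball x₁ (ρ * r')))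
        ≤ ∫⁻ t in Ioo (t₁ - (ρ * r') ^ 2) t₁, ∫⁻ x in ball x₁ (ρ * r'), F (t, x) := lintegral_prod_le _
      _ ≤ ∫⁻ t in Icc (t₁ - (ρ * r') ^ 2) t₁, ∫⁻ x in ball x₁ (ρ * r'), F (t, x) :=
          lintegral_mono_set Ioo_subset_Icc_self
      _ = ENNReal.ofReal (3 * ρ ^ 4) * ∫⁻ t in Icc (t₁ - (ρ * r') ^ 2) t₁,
            ∫⁻ x in ball x₁ (ρ * r'), ENNReal.ofReal (‖fderiv ℝ (u t) x‖ ^ 2) := by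
          rw [← lintegral_const_mul' _ _ ENNReal.ofReal_ne_top]
          refine lintegral_congr fun t => ?_
          rw [← lintegral_const_mul' _ _ ENNReal.ofReal_ne_top]
      _ ≤ ENNReal.ofReal (3 * ρ ^ 4) * ENNReal.ofReal (C * (ρ * r')) := mul_le_mul' le_rfl hE
  -- assemble
  rw [cknE]
  calc (ENNReal.ofReal r')⁻¹ * ∫⁻ q in parabolicCylinder r' z',
        ENNReal.ofReal (frobeniusNormSq (fderiv ℝ ((ρ • stPull (ρ ^ 2) ρ T x₀ u) q.1) q.2))
      ≤ (ENNReal.ofReal r')⁻¹ * ∫⁻ q in parabolicCylinder r' z', F (stAffine (ρ ^ 2) ρ T x₀ q) :=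
        mul_le_mul' le_rfl (lintegral_mono fun q => hpt q)
    _ = (ENNReal.ofReal r')⁻¹ * (ENNReal.ofReal (ρ ^ 2 * ρ ^ 3)⁻¹ * ∫⁻ z in S, F z) := by rw [hsub]
    _ ≤ (ENNReal.ofReal r')⁻¹ * (ENNReal.ofReal (ρ ^ 2 * ρ ^ 3)⁻¹ *
          (ENNReal.ofReal (3 * ρ ^ 4) * ENNReal.ofReal (C * (ρ * r')))) := by gcongr
    _ = ENNReal.ofReal (3 * C) := by
        rw [← ENNReal.ofReal_inv_of_pos hr', ← ENNReal.ofReal_mul (by positivity),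
          ← ENNReal.ofReal_mul (by positivity), ← ENNReal.ofReal_mul (by positivity)]
        congr 1
        field_simp

/-- **The `D` part of the uniform local Type-I bound of the zoom.**  If the frame obeys the
`D`-clause of `UniformScaledEnergy` at the vertex `(T + ρ²z'.1, x₀ + ρz'.2)` and radius `ρr'`, then
`D(Q(z',r'); q) ≤ C` for `q = ρ² • stPull (ρ²) ρ T x₀ p` (the ball mean is scale covariant, so
`q − ⨍q = ρ²(p − ⨍p)∘Φ`; substitution `dz = ρ⁵ dz'`). [folklore] -/
theorem cknDOsc_zoom_le {ρ C T r' : ℝ} (hρ : 0 < ρ) (hr' : 0 < r')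
    {x₀ : EuclideanSpace ℝ (Fin 3)} {p : ℝ → EuclideanSpace ℝ (Fin 3) → ℝ}
    {z' : ℝ × EuclideanSpace ℝ (Fin 3)}
    (hD : ∫⁻ t in Icc (T + ρ ^ 2 * z'.1 - (ρ * r') ^ 2) (T + ρ ^ 2 * z'.1),
      ∫⁻ x in ball (x₀ + ρ • z'.2) (ρ * r'),
        ENNReal.ofReal (|p t x - ⨍ y in ball (x₀ + ρ • z'.2) (ρ * r'), p t y| ^ (3 / 2 : ℝ)) ≤
        ENNReal.ofReal (C * (ρ * r') ^ 2)) :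
    cknDOsc r' z' (ρ ^ 2 • stPull (ρ ^ 2) ρ T x₀ p) ≤ ENNReal.ofReal C := by
  have hρ2 : 0 < ρ ^ 2 := by positivity
  set t₁ : ℝ := T + ρ ^ 2 * z'.1 with ht₁
  set x₁ : EuclideanSpace ℝ (Fin 3) := x₀ + ρ • z'.2 with hx₁
  set S : Set (ℝ × EuclideanSpace ℝ (Fin 3)) := parabolicCylinder (ρ * r') ((t₁, x₁) : ℝ × _) with hS
  set F : ℝ × EuclideanSpace ℝ (Fin 3) → ℝ≥0∞ := fun z =>
    ENNReal.ofReal (ρ ^ 3) * ENNReal.ofReal (|p z.1 z.2 - ⨍ y in ball x₁ (ρ * r'), p z.1 y| ^ (3 / 2 : ℝ))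
    with hF
  -- pointwise identity of the integrands
  have hpt : ∀ z : ℝ × EuclideanSpace ℝ (Fin 3),
      ‖(ρ ^ 2 • stPull (ρ ^ 2) ρ T x₀ p) z.1 z.2 -
          ⨍ y in ball z'.2 r', (ρ ^ 2 • stPull (ρ ^ 2) ρ T x₀ p) z.1 y‖ₑ ^ (3 / 2 : ℝ) =
        F (stAffine (ρ ^ 2) ρ T x₀ z) := by
    intro z
    have hmean : ⨍ y in ball z'.2 r', (ρ ^ 2 • stPull (ρ ^ 2) ρ T x₀ p) z.1 y =
        ρ ^ 2 * ⨍ y in ball x₁ (ρ * r'), p (T + ρ ^ 2 * z.1) y := by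
      simp_rw [smul_stPull_apply, smul_eq_mul]
      rw [hx₁, ← setAverage_ball_zoom (p (T + ρ ^ 2 * z.1)) hρ x₀ z'.2 r']
      simp only [setAverage_eq, integral_const_mul, smul_eq_mul]
      ring
    rw [hmean, smul_stPull_apply, smul_eq_mul, ← mul_sub, hF, stAffine_apply]
    dsimp only
    rw [Real.enorm_eq_ofReal_abs, abs_mul, abs_of_pos hρ2,
      ENNReal.ofReal_rpow_of_nonneg (by positivity) (by norm_num),
      Real.mul_rpow hρ2.le (abs_nonneg _), ENNReal.ofReal_mul (by positivity)]
    congr 2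
    rw [show (ρ ^ 2 : ℝ) = ρ ^ (2 : ℝ) by norm_cast, ← Real.rpow_mul hρ.le]
    norm_num
  have hpre : stAffine (ρ ^ 2) ρ T x₀ ⁻¹' S = parabolicCylinder r' z' := by
    rw [hS, ht₁, hx₁]; exact stAffine_preimage_parabolicCylinder hρ T x₀ r' z'
  have hsub := setLIntegral_preimage_comp_stAffine hρ2 hρ T x₀ F S
  rw [hpre, finrank_euclideanSpace_fin] at hsub
  have hFS : ∫⁻ z in S, F z ≤ ENNReal.ofReal (ρ ^ 3) * ENNReal.ofReal (C * (ρ * r') ^ 2) := by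
    rw [hS, parabolicCylinder]
    dsimp only
    rw [Measure.volume_eq_prod, ← Measure.prod_restrict]
    calc ∫⁻ z, F z ∂(volume.restrict (Ioo (t₁ - (ρ * r') ^ 2) t₁)).prod (volume.restrict (ball x₁ (ρ * r')))
        ≤ ∫⁻ t in Ioo (t₁ - (ρ * r') ^ 2) t₁, ∫⁻ x in ball x₁ (ρ * r'), F (t, x) := lintegral_prod_le _
      _ ≤ ∫⁻ t in Icc (t₁ - (ρ * r') ^ 2) t₁, ∫⁻ x in ball x₁ (ρ * r'), F (t, x) :=
          lintegral_mono_set Ioo_subset_Icc_self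
      _ = ENNReal.ofReal (ρ ^ 3) * ∫⁻ t in Icc (t₁ - (ρ * r') ^ 2) t₁, ∫⁻ x in ball x₁ (ρ * r'),
            ENNReal.ofReal (|p t x - ⨍ y in ball x₁ (ρ * r'), p t y| ^ (3 / 2 : ℝ)) := by
          rw [← lintegral_const_mul' _ _ ENNReal.ofReal_ne_top]
          refine lintegral_congr fun t => ?_
          rw [← lintegral_const_mul' _ _ ENNReal.ofReal_ne_top]
      _ ≤ ENNReal.ofReal (ρ ^ 3) * ENNReal.ofReal (C * (ρ * r') ^ 2) := mul_le_mul' le_rfl hD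
  rw [cknDOsc]
  calc (ENNReal.ofReal r' ^ 2)⁻¹ * ∫⁻ w in parabolicCylinder r' z',
        ‖(ρ ^ 2 • stPull (ρ ^ 2) ρ T x₀ p) w.1 w.2 -
          ⨍ y in ball z'.2 r', (ρ ^ 2 • stPull (ρ ^ 2) ρ T x₀ p) w.1 y‖ₑ ^ (3 / 2 : ℝ)
      = (ENNReal.ofReal r' ^ 2)⁻¹ * ∫⁻ w in parabolicCylinder r' z', F (stAffine (ρ ^ 2) ρ T x₀ w) := by
        congr 1
        exact lintegral_congr fun w => hpt w
    _ = (ENNReal.ofReal r' ^ 2)⁻¹ * (ENNReal.ofReal (ρ ^ 2 * ρ ^ 3)⁻¹ * ∫⁻ z in S, F z) := by rw [hsub]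
    _ ≤ (ENNReal.ofReal r' ^ 2)⁻¹ * (ENNReal.ofReal (ρ ^ 2 * ρ ^ 3)⁻¹ *
          (ENNReal.ofReal (ρ ^ 3) * ENNReal.ofReal (C * (ρ * r') ^ 2))) := by gcongr
    _ = ENNReal.ofReal C := by
        rw [← ENNReal.ofReal_pow hr'.le, ← ENNReal.ofReal_inv_of_pos (by positivity),
          ← ENNReal.ofReal_mul (by positivity), ← ENNReal.ofReal_mul (by positivity),
          ← ENNReal.ofReal_mul (by positivity)]
        congr 1
        field_simp

/-- `∫_a^b (−s)^{-1/2} ds ≤ 2 √(b − a)` for `a ≤ b ≤ 0`, in `ℝ≥0∞` form (primitive `−2√(−s)`).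
[folklore] -/
theorem lintegral_rpow_neg_half_le {a b : ℝ} (hab : a ≤ b) (hb : b ≤ 0) :
    ∫⁻ s in Ioo a b, ENNReal.ofReal ((-s) ^ (-(1 / 2 : ℝ))) ≤ ENNReal.ofReal (2 * Real.sqrt (b - a)) := by
  have hnn : ∀ s ∈ Ioo a b, 0 ≤ (-s) ^ (-(1 / 2 : ℝ)) := fun s hs =>
    Real.rpow_nonneg (by linarith [hs.2]) _
  have hgc : Continuous fun s : ℝ => -2 * Real.sqrt (-s) :=
    continuous_const.mul (Real.continuous_sqrt.comp continuous_neg)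
  have hderiv : ∀ s ∈ Ioo a b,
      HasDerivAt (fun s : ℝ => -2 * Real.sqrt (-s)) ((-s) ^ (-(1 / 2 : ℝ))) s := by
    intro s hs
    have hs0 : 0 < -s := by linarith [hs.2]
    have h1 : HasDerivAt (fun s : ℝ => -s) (-1) s := (hasDerivAt_id s).neg
    have h2 := (h1.sqrt hs0.ne').const_mul (-2)
    have e : -2 * (-1 / (2 * Real.sqrt (-s))) = (-s) ^ (-(1 / 2 : ℝ)) := by
      rw [Real.rpow_neg hs0.le, ← Real.sqrt_eq_rpow]
      field_simp
    exact h2.congr_deriv e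
  have hint : IntegrableOn (fun s : ℝ => (-s) ^ (-(1 / 2 : ℝ))) (Ioo a b) volume :=
    (intervalIntegral.integrableOn_deriv_of_nonneg hgc.continuousOn hderiv hnn).mono_set
      Ioo_subset_Ioc_self
  rw [← ofReal_integral_eq_lintegral_ofReal hint ((ae_restrict_mem measurableSet_Ioo).mono hnn)]
  refine ENNReal.ofReal_le_ofReal ?_
  rw [← integral_Ioc_eq_integral_Ioo, ← intervalIntegral.integral_of_le hab,
    intervalIntegral.integral_eq_sub_of_hasDerivAt_of_le hab hgc.continuousOn hderiv
      ((intervalIntegrable_iff_integrableOn_Ioo_of_le hab).2 hint)]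
  -- `−2√(−b) + 2√(−a) ≤ 2√(b − a)` since `√(−a) ≤ √(−b) + √(b − a)`
  have hx : 0 ≤ -b := by linarith
  have hy : 0 ≤ b - a := by linarith
  have h1 : Real.sqrt (-a) ≤ Real.sqrt (-b) + Real.sqrt (b - a) := by
    calc Real.sqrt (-a) = Real.sqrt (-b + (b - a)) := by ring_nf
      _ ≤ Real.sqrt ((Real.sqrt (-b) + Real.sqrt (b - a)) ^ 2) :=
          Real.sqrt_le_sqrt (by
            nlinarith [Real.sq_sqrt hx, Real.sq_sqrt hy, Real.sqrt_nonneg (-b),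
              Real.sqrt_nonneg (b - a)])
      _ = Real.sqrt (-b) + Real.sqrt (b - a) := Real.sqrt_sq (by positivity)
  linarith [Real.sqrt_nonneg (-b)]

end Summit.NavierStokesRegularity.NavierStokesRegularity.Theorems.ThinCascade

end
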